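import Mathlib.Analysis.InnerProductSpace.Adjoint
import Mathlib.Analysis.InnerProductSpace.PiL2
import Mathlib.LinearAlgebra.FiniteDimensional.Basic
import Literature.Geometry.Lorentzian.BoundedGeometry
import Literature.Geometry.Lorentzian.KerrSchildWaveCauchyAssembly
import Summits.FinalStateConjecture.FinalStateConjecture.Theorems.EIHFluxBalanceInertialRecessionStubSlavingCoercivity

/-!
# Route EIHFluxBalance — `ModulatedKerrHandoff`, stub `stub_annulusRigidity`: Euclidean norms of the Minkowski form

Helper file for the crux `stmt-FinalStateConjecture-10167`
(`Summit.FinalStateConjecture.FinalStateConjecture.Theses.EIHFluxBalance.ModulatedKerrHandoff`),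
line `overlap-modulation-second-iterate`, stub `stub_annulusRigidity` (rigidity of almost-isometric
`C²` maps of a Minkowski annulus).

All operator norms in the stub are taken with respect to the EUCLIDEAN norm of
`E4 = EuclideanSpace ℝ (Fin 4)`. This file records the elementary interplay of the Minkowski form
`η = Minkowski.bilin` with that norm, through the time reflection `θ = KerrSchild.timeReflect`
(`θ(t, y⃗) = (−t, y⃗)`, tree file `KerrSchildWaveCauchyAssembly.lean`):

* `η(v, w) = ⟪θ v, w⟫`, `‖θ v‖ = ‖v‖`, `η(v, θ v) = ‖v‖²`, `‖η(v, ·)‖ ≤ ‖v‖` (with the tree's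
  `Minkowski.abs_bilin_le` of `BoundedGeometry.lean` and `norm_le_norm_minkowski_bilin` of
  `…InertialRecessionStubSlavingCoercivity.lean` the musical map `η♭` is a Euclidean isometry),
  `‖η(P v, Q ·)‖ ≤ ‖P v‖ ‖Q‖`;
* `θ` is Euclidean-self-adjoint, and the `η`-ADJOINT `X ↦ θ ∘ X† ∘ θ` of an endomorphism `X`
  (`X†` the Euclidean adjoint) satisfies `η(θ X† θ v, w) = η(v, X w)`; it is an involutive
  anti-automorphism of the ring `E4 →L[ℝ] E4`;
* the DEFECT ENDOMORPHISM `θ X† θ X − 1` of `X` represents the defect form `η(X ·, X ·) − η`, so its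
  operator norm is at most the norm of that form;
* quantitative injectivity/surjectivity of an endomorphism `B` whose pulled-back form
  `η(B ·, B ·)` is close to `η`: `(1 − ‖η(B·,B·) − η‖) ‖v‖ ≤ ‖B‖ ‖B v‖`, and every vector has a
  preimage of controlled norm.

O'Neill, *Semi-Riemannian geometry* (1983), Ch. 9 (the Lorentz group as `η`-isometries);
folklore linear algebra. [folklore]
-/

noncomputable section

-- `Summit.<S>.<S>.…` (single-problem summit, D-0017) trips core's duplicate-namespace linter.
set_option linter.dupNamespace false

open scoped InnerProductSpace
open Literature.Geometry.Lorentzian Literature.Geometry.Lorentzian.KerrSchild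

namespace Summit.FinalStateConjecture.FinalStateConjecture.Theorems

namespace AnnulusRigidity

/-! ### The time reflection and the Euclidean norm -/

/-- `η(v, w) = ⟪θ v, w⟫`: the Minkowski form is the Euclidean inner product twisted by the time
reflection. [folklore] -/
theorem inner_timeReflect_left (v w : E4) :
    ⟪timeReflect v, w⟫_ℝ = Minkowski.bilin v w := by
  simp [PiLp.inner_apply, Fin.sum_univ_four, Fin.sum_univ_three, timeReflect_apply, timeSign]
  ring

/-- The time reflection is a Euclidean isometry. [folklore] -/
theorem norm_timeReflect (v : E4) : ‖timeReflect v‖ = ‖v‖ := by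
  have h1 : ‖timeReflect v‖ ^ 2 = ‖v‖ ^ 2 := by
    rw [EuclideanSpace.real_norm_sq_eq, EuclideanSpace.real_norm_sq_eq]
    simp [Fin.sum_univ_four, timeReflect_apply, timeSign]
  exact (pow_left_inj₀ (norm_nonneg _) (norm_nonneg _) two_ne_zero).1 h1

/-- `η(v, θ v) = ‖v‖²`. [folklore] -/
theorem bilin_self_timeReflect (v : E4) : Minkowski.bilin v (timeReflect v) = ‖v‖ ^ 2 := by
  rw [EuclideanSpace.real_norm_sq_eq]
  simp [Fin.sum_univ_four, Fin.sum_univ_three, timeReflect_apply, timeSign]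
  ring

/-- `‖η(v, ·)‖ ≤ ‖v‖`. [folklore] -/
theorem norm_bilin_apply_le (v : E4) : ‖Minkowski.bilin v‖ ≤ ‖v‖ :=
  ContinuousLinearMap.opNorm_le_bound _ (norm_nonneg _) fun w ↦ by
    rw [Real.norm_eq_abs]; exact Minkowski.abs_bilin_le v w

/-- `‖η(P v, ·) ∘ Q‖ ≤ ‖P v‖ ‖Q‖`: the partially applied pulled-back form. [folklore] -/
theorem norm_bilinearComp_apply_le (P Q : E4 →L[ℝ] E4) (v : E4) :
    ‖Minkowski.bilin.bilinearComp P Q v‖ ≤ ‖P v‖ * ‖Q‖ :=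
  ContinuousLinearMap.opNorm_le_bound _ (by positivity) fun w ↦ by
    rw [ContinuousLinearMap.bilinearComp_apply, Real.norm_eq_abs]
    calc |Minkowski.bilin (P v) (Q w)| ≤ ‖P v‖ * ‖Q w‖ := Minkowski.abs_bilin_le _ _
      _ ≤ ‖P v‖ * (‖Q‖ * ‖w‖) := mul_le_mul_of_nonneg_left (Q.le_opNorm w) (norm_nonneg _)
      _ = ‖P v‖ * ‖Q‖ * ‖w‖ := by ring

/-! ### The `η`-adjoint `θ X† θ` -/

/-- `θ ∘ θ = 1` in the ring `E4 →L[ℝ] E4`. [folklore] -/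
theorem timeReflect_mul_timeReflect :
    (timeReflect : E4 →L[ℝ] E4) * (timeReflect : E4 →L[ℝ] E4) = 1 := by
  ext1 v
  simp

/-- The time reflection is Euclidean-self-adjoint (`X† = star X` on `E4 →L[ℝ] E4`). [folklore] -/
theorem star_timeReflect : star (timeReflect : E4 →L[ℝ] E4) = timeReflect := by
  rw [ContinuousLinearMap.star_eq_adjoint]
  symm
  rw [ContinuousLinearMap.eq_adjoint_iff]
  intro x y
  rw [ContinuousLinearEquiv.coe_coe, inner_timeReflect_left, Minkowski.bilin_symm,
    ← inner_timeReflect_left, real_inner_comm]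

/-- The `η`-adjoint is an adjoint for `η`: `η(θ X† θ v, w) = η(v, X w)`. [folklore] -/
theorem bilin_etaAdjoint_apply (X : E4 →L[ℝ] E4) (v w : E4) :
    Minkowski.bilin (((timeReflect : E4 →L[ℝ] E4) * star X * (timeReflect : E4 →L[ℝ] E4)) v) w =
      Minkowski.bilin v (X w) := by
  rw [← inner_timeReflect_left, ← inner_timeReflect_left]
  simp only [mul_apply_eq_comp, ContinuousLinearEquiv.coe_coe, timeReflect_timeReflect,
    ContinuousLinearMap.star_eq_adjoint]
  rw [ContinuousLinearMap.adjoint_inner_left]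

/-- `η(θ X† θ X v, w) = η(X v, X w)`: the `η`-Gram endomorphism represents the pulled-back form.
[folklore] -/
theorem bilin_etaAdjoint_mul_self_apply (X : E4 →L[ℝ] E4) (v w : E4) :
    Minkowski.bilin (((timeReflect : E4 →L[ℝ] E4) * star X * (timeReflect : E4 →L[ℝ] E4) * X) v)
      w = Minkowski.bilin (X v) (X w) := by
  rw [mul_apply_eq_comp, bilin_etaAdjoint_apply]

/-- The `η`-adjoint is an anti-homomorphism: `θ (X Y)† θ = (θ Y† θ) (θ X† θ)`. [folklore] -/
theorem etaAdjoint_mul (X Y : E4 →L[ℝ] E4) :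
    (timeReflect : E4 →L[ℝ] E4) * star (X * Y) * (timeReflect : E4 →L[ℝ] E4) =
      ((timeReflect : E4 →L[ℝ] E4) * star Y * (timeReflect : E4 →L[ℝ] E4)) *
        ((timeReflect : E4 →L[ℝ] E4) * star X * (timeReflect : E4 →L[ℝ] E4)) := by
  rw [star_mul]
  calc (timeReflect : E4 →L[ℝ] E4) * (star Y * star X) * (timeReflect : E4 →L[ℝ] E4)
      = (timeReflect : E4 →L[ℝ] E4) * star Y *
          ((timeReflect : E4 →L[ℝ] E4) * (timeReflect : E4 →L[ℝ] E4)) * star X *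
          (timeReflect : E4 →L[ℝ] E4) := by
        rw [timeReflect_mul_timeReflect, mul_one]; simp only [mul_assoc]
    _ = _ := by simp only [mul_assoc]

/-- The `η`-adjoint is an involution: `θ (θ X† θ)† θ = X`. [folklore] -/
theorem etaAdjoint_etaAdjoint (X : E4 →L[ℝ] E4) :
    (timeReflect : E4 →L[ℝ] E4) *
        star ((timeReflect : E4 →L[ℝ] E4) * star X * (timeReflect : E4 →L[ℝ] E4)) *
        (timeReflect : E4 →L[ℝ] E4) = X := by
  rw [star_mul, star_mul, star_star, star_timeReflect]
  calc (timeReflect : E4 →L[ℝ] E4) * ((timeReflect : E4 →L[ℝ] E4) *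
        (X * (timeReflect : E4 →L[ℝ] E4))) * (timeReflect : E4 →L[ℝ] E4)
      = ((timeReflect : E4 →L[ℝ] E4) * (timeReflect : E4 →L[ℝ] E4)) * X *
          ((timeReflect : E4 →L[ℝ] E4) * (timeReflect : E4 →L[ℝ] E4)) := by
        simp only [mul_assoc]
    _ = X := by rw [timeReflect_mul_timeReflect, one_mul, mul_one]

/-- The `η`-adjoint of the identity is the identity. [folklore] -/
theorem etaAdjoint_one :
    (timeReflect : E4 →L[ℝ] E4) * star (1 : E4 →L[ℝ] E4) * (timeReflect : E4 →L[ℝ] E4) = 1 := by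
  rw [star_one, mul_one, timeReflect_mul_timeReflect]

/-! ### Scalars and `star` in the algebra `E4 →L[ℝ] E4`

The generic lemmas `smul_mul_assoc`, `mul_smul_comm`, `star_sub`, `star_smul` do not fire under
`rw` on `E4 →L[ℝ] E4` (the scalar action found by unification is `ContinuousLinearMap.instSMul`,
not `Algebra.toSMul`); we restate them once in the syntactic form used below. -/

/-- `(c • X) Y = c • (X Y)` in `E4 →L[ℝ] E4`. [folklore] -/
theorem smul_mul_assoc' (c : ℝ) (X Y : E4 →L[ℝ] E4) : c • X * Y = c • (X * Y) :=
  Algebra.smul_mul_assoc c X Y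

/-- `X (c • Y) = c • (X Y)` in `E4 →L[ℝ] E4`. [folklore] -/
theorem mul_smul_comm' (c : ℝ) (X Y : E4 →L[ℝ] E4) : X * c • Y = c • (X * Y) :=
  Algebra.mul_smul_comm c X Y

/-- `(X − Y)† = X† − Y†`. [folklore] -/
theorem star_sub' (X Y : E4 →L[ℝ] E4) : star (X - Y) = star X - star Y := star_sub X Y

/-- `(c • X)† = c • X†` over `ℝ`. [folklore] -/
theorem star_smul' (c : ℝ) (X : E4 →L[ℝ] E4) : star (c • X) = c • star X :=
  (star_smul c X).trans (by rw [star_trivial])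

/-- The `η`-adjoint commutes with subtraction. [folklore] -/
theorem etaAdjoint_sub (X Y : E4 →L[ℝ] E4) :
    (timeReflect : E4 →L[ℝ] E4) * star (X - Y) * (timeReflect : E4 →L[ℝ] E4) =
      (timeReflect : E4 →L[ℝ] E4) * star X * (timeReflect : E4 →L[ℝ] E4) -
        (timeReflect : E4 →L[ℝ] E4) * star Y * (timeReflect : E4 →L[ℝ] E4) := by
  rw [star_sub', mul_sub, sub_mul]

/-- The `η`-adjoint commutes with real scalars. [folklore] -/
theorem etaAdjoint_smul (c : ℝ) (X : E4 →L[ℝ] E4) :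
    (timeReflect : E4 →L[ℝ] E4) * star (c • X) * (timeReflect : E4 →L[ℝ] E4) =
      c • ((timeReflect : E4 →L[ℝ] E4) * star X * (timeReflect : E4 →L[ℝ] E4)) := by
  rw [star_smul', mul_smul_comm', smul_mul_assoc']

/-! ### The defect endomorphism `θ X† θ X − 1` -/

/-- The defect endomorphism represents the defect form:
`η((θ X† θ X − 1) v, w) = η(X v, X w) − η(v, w)`. [folklore] -/
theorem bilin_defect_apply (X : E4 →L[ℝ] E4) (v w : E4) :
    Minkowski.bilin (((timeReflect : E4 →L[ℝ] E4) * star X * (timeReflect : E4 →L[ℝ] E4) * X - 1)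
      v) w = (Minkowski.bilin.bilinearComp X X - Minkowski.bilin) v w := by
  simp only [sub_apply, map_sub, bilin_etaAdjoint_mul_self_apply, one_apply_eq_self,
    ContinuousLinearMap.bilinearComp_apply]

/-- The operator norm of the defect endomorphism is at most the norm of the defect form
(`η♭` is a Euclidean isometry). [folklore] -/
theorem norm_defect_le (X : E4 →L[ℝ] E4) :
    ‖(timeReflect : E4 →L[ℝ] E4) * star X * (timeReflect : E4 →L[ℝ] E4) * X - 1‖ ≤
      ‖Minkowski.bilin.bilinearComp X X - Minkowski.bilin‖ := by
  refine ContinuousLinearMap.opNorm_le_bound _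
    (norm_nonneg (Minkowski.bilin.bilinearComp X X - Minkowski.bilin)) fun v ↦ ?_
  have h : Minkowski.bilin (((timeReflect : E4 →L[ℝ] E4) * star X *
      (timeReflect : E4 →L[ℝ] E4) * X - 1) v) =
      (Minkowski.bilin.bilinearComp X X - Minkowski.bilin) v :=
    ContinuousLinearMap.ext fun w ↦ bilin_defect_apply X v w
  calc _ ≤ ‖Minkowski.bilin (((timeReflect : E4 →L[ℝ] E4) * star X *
        (timeReflect : E4 →L[ℝ] E4) * X - 1) v)‖ :=
          SublinearIsFree.Slaving.norm_le_norm_minkowski_bilin _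
    _ = ‖(Minkowski.bilin.bilinearComp X X - Minkowski.bilin) v‖ := by rw [h]
    _ ≤ _ := ContinuousLinearMap.le_opNorm _ _

/-- The defect endomorphism is `η`-self-adjoint. [folklore] -/
theorem etaAdjoint_defect (X : E4 →L[ℝ] E4) :
    (timeReflect : E4 →L[ℝ] E4) *
        star ((timeReflect : E4 →L[ℝ] E4) * star X * (timeReflect : E4 →L[ℝ] E4) * X - 1) *
        (timeReflect : E4 →L[ℝ] E4) =
      (timeReflect : E4 →L[ℝ] E4) * star X * (timeReflect : E4 →L[ℝ] E4) * X - 1 := by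
  rw [etaAdjoint_sub, etaAdjoint_one, etaAdjoint_mul, etaAdjoint_etaAdjoint]

/-! ### Almost-isometries are quantitatively invertible -/

/-- If `η(B ·, B ·)` is close to `η` then `B` is bounded below:
`(1 − ‖η(B·,B·) − η‖) ‖v‖ ≤ ‖B‖ ‖B v‖`. [folklore] -/
theorem sub_norm_defect_mul_norm_le (B : E4 →L[ℝ] E4) (v : E4) :
    (1 - ‖Minkowski.bilin.bilinearComp B B - Minkowski.bilin‖) * ‖v‖ ≤ ‖B‖ * ‖B v‖ := by
  have h1 : ‖v‖ ≤ ‖Minkowski.bilin.bilinearComp B B v‖ +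
      ‖(Minkowski.bilin.bilinearComp B B - Minkowski.bilin) v‖ := by
    calc ‖v‖ ≤ ‖Minkowski.bilin v‖ := SublinearIsFree.Slaving.norm_le_norm_minkowski_bilin v
      _ = ‖Minkowski.bilin.bilinearComp B B v -
            (Minkowski.bilin.bilinearComp B B - Minkowski.bilin) v‖ := by
          rw [sub_apply, sub_sub_cancel]
      _ ≤ _ := norm_sub_le _ _
  have h2 : ‖Minkowski.bilin.bilinearComp B B v‖ ≤ ‖B‖ * ‖B v‖ := by
    rw [mul_comm]; exact norm_bilinearComp_apply_le B B v
  have h3 := (Minkowski.bilin.bilinearComp B B - Minkowski.bilin).le_opNorm v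
  rw [sub_mul, one_mul]
  linarith

/-- If `‖B‖ ≤ Γ` and `‖η(B·,B·) − η‖ ≤ ε < 1` then every vector `t` has a `B`-preimage `w` with
`(1 − ε) ‖w‖ ≤ Γ ‖t‖` (`B` is injective by the lower bound, hence surjective: `E4` is
finite-dimensional). [folklore] -/
theorem exists_preimage_norm_le {B : E4 →L[ℝ] E4} {Γ ε : ℝ} (hB : ‖B‖ ≤ Γ)
    (hd : ‖Minkowski.bilin.bilinearComp B B - Minkowski.bilin‖ ≤ ε) (hε : ε < 1) (t : E4) :
    ∃ w : E4, B w = t ∧ (1 - ε) * ‖w‖ ≤ Γ * ‖t‖ := by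
  have hlow : ∀ v : E4, (1 - ε) * ‖v‖ ≤ Γ * ‖B v‖ := fun v ↦
    calc (1 - ε) * ‖v‖ ≤ (1 - ‖Minkowski.bilin.bilinearComp B B - Minkowski.bilin‖) * ‖v‖ :=
          mul_le_mul_of_nonneg_right (by linarith) (norm_nonneg _)
      _ ≤ ‖B‖ * ‖B v‖ := sub_norm_defect_mul_norm_le B v
      _ ≤ Γ * ‖B v‖ := mul_le_mul_of_nonneg_right hB (norm_nonneg _)
  have hinj : Function.Injective (B : E4 →ₗ[ℝ] E4) := by
    intro v v' hvv'
    rw [← sub_eq_zero, ← norm_le_zero_iff]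
    have h := hlow (v - v')
    rw [map_sub, show B v - B v' = 0 from sub_eq_zero.2 hvv', norm_zero, mul_zero] at h
    nlinarith [norm_nonneg (v - v')]
  obtain ⟨w, hw⟩ := (LinearMap.injective_iff_surjective.1 hinj) t
  exact ⟨w, hw, hw ▸ hlow w⟩

end AnnulusRigidity

/-- Registered sub-goal form (stub `annulusRigidity_norm_defect_le` of the crux item, helper for `stub_annulusRigidity`) of
`AnnulusRigidity.norm_defect_le`: the operator norm of the defect endomorphism `θ X† θ X − 1` is at most the norm of the defect form
`η(X·, X·) − η`. [folklore] -/
theorem annulusRigidity_norm_defect_le : open Literature.Geometry.Lorentzian Literature.Geometry.Lorentzian.KerrSchild in ∀ X : E4 →L[ℝ] E4, ‖(timeReflect : E4 →L[ℝ] E4) * star X * (timeReflect : E4 →L[ℝ] E4) * X - 1‖ ≤ ‖Minkowski.bilin.bilinearComp X X - Minkowski.bilin‖ :=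
  fun X ↦ AnnulusRigidity.norm_defect_le X

end Summit.FinalStateConjecture.FinalStateConjecture.Theorems

end
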